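import Literature.Topology.FourManifolds.KnotTraceUniqueness
import Literature.Topology.FourManifolds.TwoHandleTubeDeformationFour
import Literature.AlgebraicTopology.FundamentalGroup.VanKampenPieces
import Literature.AlgebraicTopology.FundamentalGroup.CircleAndTorus
import Literature.AlgebraicTopology.FundamentalGroup.SphereSimplyConnected
import Mathlib.Analysis.Convex.Contractible
import HarnessLib

/-!
# The trace `B⁴ ∪_L (2-handles)` of a framed link is simply connected

Topic `Literature/Topology/FourManifolds`.  Gompf–Scharlemann–Thompson, *Fibered knots and
potential counterexamples to the Property 2R and Slice-Ribbon Conjectures*, Geom. Topol. 14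
(2010), §9 (arXiv:1103.1601, p. 19): the closed `4`-manifold `W = D⁴ ∪_L (2-handles) ∪ ♮ⁿ S¹ × B³`
is *"simply-connected (since no `1`-handles are attached)"*; Gompf–Stipsicz, *4-Manifolds and
Kirby Calculus* (1999), §4.4: a handlebody without `1`-handles is simply connected
(van Kampen: each `2`-handle `D² × D²` is contractible and meets the `0`-handle in the connected
`S¹ × D²`).  This file proves the first half of that sentence for the tree's compact trace
`FramedLink.IsTrace L P` (`RLinkSphere.lean`; the realization `DottedCircleDiagram.Realization` of
the Kirby diagram of `L` without dotted circles, in Kosinski's corner-free model of handle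
attachment, `HandleAttachingMaps.lean`, Kosinski 1993, VI §6):

* `simplyConnectedSpace_of_isOpen_of_iUnion` — **van Kampen, trivial groups, one piece meeting
  finitely many pairwise disjoint pieces**: if `Y = A ∪ ⋃ᵢ Bᵢ` with `A`, `Bᵢ` open and simply
  connected, the `Bᵢ` pairwise disjoint and each `A ∩ Bᵢ` path connected (nonempty), then `Y` is
  simply connected (Hatcher 2002, Lemma 1.15 / Prop. 1.26 (a), the tree's
  `VanKampen.ker_le_and_surjective_inclHomOfSubset_union_iUnion`);
* `HandleAttachingMap.IsMultiAttachment.range_jA_inter_range_jB` — in any Kosinski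
  multi-attachment the base piece meets the `i`-th handle piece in the image of the punctured
  tube `T ∖ S` (any dimension and index; the `5`-dimensional special case is
  `HandleAttachingMap.range_inter_range_eq_image`, `TwoHandleAttachmentPi1.lean`);
* `DottedCircleDiagram.Realization.contractibleSpace_coresComplement` — for a realization of
  `ofFramedLink L` the carved ball *is* `D⁴` (no dotted circles; cf.
  `Realization.exists_carvedDiffeomorph`, `KnotTraceUniqueness.lean`) and `D⁴` minus the attaching
  circles, which lie on `∂D⁴`, is star-shaped about the centre, hence contractible;
* `DottedCircleDiagram.Realization.simplyConnectedSpace_of_ofFramedLink`,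
  **`FramedLink.IsTrace.simplyConnectedSpace`** — the trace is simply connected (Kosinski's open
  cover of `P` by `D⁴ ∖ ⋃ cores` and the handle pieces `D⁴ ∖ S`, contractible by
  `contractibleSpace_beltPiece₄`, glued along the connected regions `T ∖ S`,
  `isPathConnected_beltPiece₄_lamSq_ne_zero`); also `FramedLink.IsTrace.nonempty`.

Everything is proved; no definitions, no named facts.

## References

* R. E. Gompf, M. Scharlemann, A. Thompson, Geom. Topol. 14 (2010) 2305–2347, §9
  (arXiv:1103.1601, p. 19). [GompfScharlemannThompson2010]
* R. E. Gompf, A. I. Stipsicz, *4-Manifolds and Kirby Calculus*, GSM 20 (1999), §4.4.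
  [GompfStipsicz1999]
* A. A. Kosinski, *Differential Manifolds* (1993), VI §6, VII §7. [Kosinski1993]
* A. Hatcher, *Algebraic Topology* (2002), §1.2 Lemma 1.15, Prop. 1.26; Ch. 0 p. 4 (star-shaped
  sets). [HatcherAT2002]
-/

open scoped Manifold ContDiff Topology
open Set Function Metric Topology

noncomputable section

namespace Literature.Topology.FourManifolds

open Literature.AlgebraicTopology.FundamentalGroup
open Literature.AlgebraicTopology.FundamentalGroup.VanKampen

universe u v w

/-! ### §1 Van Kampen with trivial groups: one piece and finitely many disjoint pieces -/

section VanKampen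

variable {Y : Type*} [TopologicalSpace Y] {ι : Type*} [Finite ι] {A : Set Y} {B : ι → Set Y}

omit [Finite ι] in
/-- A union `A ∪ ⋃ᵢ Bᵢ` of path connected sets each of which meets the path connected set `A`
is path connected. [folklore] -/
theorem isPathConnected_union_iUnion_of_meet (hA : IsPathConnected A)
    (hB : ∀ i, IsPathConnected (B i)) (hmeet : ∀ i, (A ∩ B i).Nonempty) :
    IsPathConnected (A ∪ ⋃ i, B i) := by
  obtain ⟨x₀, hx₀, hJA⟩ := hA
  refine ⟨x₀, Or.inl hx₀, fun {y} hy => ?_⟩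
  rcases hy with hy | hy
  · exact (hJA hy).mono subset_union_left
  · obtain ⟨i, hyi⟩ := mem_iUnion.1 hy
    obtain ⟨z, hzA, hzB⟩ := hmeet i
    have h₁ : JoinedIn (A ∪ ⋃ i, B i) x₀ z := (hJA hzA).mono subset_union_left
    have h₂ : JoinedIn (A ∪ ⋃ i, B i) z y :=
      ((hB i).joinedIn z hzB y hyi).mono ((subset_iUnion B i).trans subset_union_right)
    exact h₁.trans h₂

/-- **A space covered by a simply connected open set `A` and finitely many pairwise disjoint
simply connected open sets `Bᵢ`, each meeting `A` in a (nonempty) path connected set, is simply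
connected** (Hatcher 2002, Lemma 1.15 and Prop. 1.26 (a): `π₁(A) → π₁(A ∪ ⋃ Bᵢ)` is onto, the
tree's `VanKampen.ker_le_and_surjective_inclHomOfSubset_union_iUnion`; this is the van Kampen
argument behind "a handlebody without `1`-handles is simply connected", Gompf–Stipsicz 1999,
§4.4). [cite: HatcherAT2002, Lemma 1.15 and Prop. 1.26 (a)] -/
theorem simplyConnectedSpace_of_isOpen_of_iUnion (hAo : IsOpen A) (hBo : ∀ i, IsOpen (B i))
    (hAsc : IsSimplyConnected A) (hBsc : ∀ i, IsSimplyConnected (B i))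
    (hmeet : ∀ i, IsPathConnected (A ∩ B i)) (hdisj : Pairwise fun i j => Disjoint (B i) (B j))
    (hcov : A ∪ ⋃ i, B i = univ) : SimplyConnectedSpace Y := by
  obtain ⟨x₀, hx₀⟩ := hAsc.nonempty
  have hApc : IsPathConnected A := hAsc.isPathConnected
  -- points of the gluing regions and paths to them inside `A`
  choose x hx using fun i => (hmeet i).nonempty
  have hJ : ∀ i, JoinedIn A x₀ (x i) := fun i => hApc.joinedIn x₀ hx₀ (x i) (hx i).1
  let η : ∀ i, Path x₀ (x i) := fun i => (hJ i).somePath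
  have hηA : ∀ i t, η i t ∈ A := fun i t => (hJ i).somePath_mem t
  -- `π₁(A) → π₁(A ∪ ⋃ Bᵢ)` is onto
  obtain ⟨-, hsurj⟩ := ker_le_and_surjective_inclHomOfSubset_union_iUnion hAo hBo hApc hBsc
    hmeet hdisj hx₀ (⊤ : Subgroup (FundamentalGroup (↥A) ⟨x₀, hx₀⟩)) x hx η hηA (fun i => by
      rintro g -
      exact Subgroup.mem_map.2 ⟨_, Subgroup.mem_top _, MulEquiv.apply_symm_apply _ g⟩)
  -- `π₁(A)` is trivial, hence so is `π₁(A ∪ ⋃ Bᵢ) = π₁(Y)`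
  haveI : SimplyConnectedSpace ↥A := hAsc.simplyConnectedSpace
  have hU : Subsingleton (FundamentalGroup ↥(A ∪ ⋃ i, B i) ⟨x₀, subset_union_left hx₀⟩) :=
    ⟨fun a b => by
      obtain ⟨a', rfl⟩ := hsurj a
      obtain ⟨b', rfl⟩ := hsurj b
      rw [Subsingleton.elim a' b']⟩
  let Ψ : ↥(A ∪ ⋃ i, B i) ≃ₜ Y := (Homeomorph.setCongr hcov).trans (Homeomorph.Set.univ Y)
  let θ := fundamentalGroupEquivOfHomeomorph Ψ (x := ⟨x₀, subset_union_left hx₀⟩) (y := x₀) rfl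
  haveI : Subsingleton (FundamentalGroup Y x₀) := θ.symm.injective.subsingleton
  -- `Y` is path connected: every piece is, and every `Bᵢ` meets `A`
  haveI : PathConnectedSpace Y := by
    rw [pathConnectedSpace_iff_univ, ← hcov]
    exact isPathConnected_union_iUnion_of_meet hApc (fun i => (hBsc i).isPathConnected)
      fun i => (hmeet i).nonempty
  exact simplyConnectedSpace_of_loops_nullhomotopic_at x₀ fun γ =>
    Path.Homotopic.Quotient.eq.mp
      (Subsingleton.elim (α := FundamentalGroup Y x₀)
        (Path.Homotopic.Quotient.mk γ) (Path.Homotopic.Quotient.mk (Path.refl _)))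

end VanKampen

/-! ### §2 Kosinski multi-attachments: the gluing region of a handle piece -/

namespace HandleAttachingMap

section Region

variable {n k : ℕ} {M : Type u} [TopologicalSpace M] [T2Space M]
  [ChartedSpace (EuclideanHalfSpace (n + 1)) M] {ι : Type*} [Finite ι]
  {h : ι → HandleAttachingMap n k M}

omit [T2Space M] [Finite ι] in
/-- With pairwise disjoint tubes, a point `h̄ᵢ(y)` with `|y_λ| ≠ 1` lies off all the attaching
spheres (any dimension and index; cf. `HandleAttachingMap.apply_mem_compl_iUnion_core` for
`5`-dimensional `2`-handles). [cite: Kosinski1993, VI §6] -/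
theorem apply_notMem_iUnion_core
    (hdisj : Pairwise fun i j => Disjoint (range (h i).toFun) (range (h j).toFun)) (i : ι)
    (y : ↥(handleTube n k)) (hy : lamSq k (y.1.1) ≠ 1) :
    (h i).toFun y ∈ (⋃ j, (h j).core)ᶜ := by
  rw [mem_compl_iff, mem_iUnion, not_exists]
  intro j hj
  obtain ⟨y', hy', he⟩ := (mem_core_iff _).1 hj
  by_cases hji : j = i
  · subst hji
    rw [← (h j).injective he] at hy
    exact hy hy'
  · exact Set.disjoint_left.1 (hdisj (Ne.symm hji)) (mem_range_self y) ⟨y', he⟩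

/-- **The gluing region of the `i`-th handle piece of a multi-attachment**:
`jA(M ∖ ⋃ h̄ⱼ(S)) ∩ jBᵢ(Dᵐ ∖ S) = jBᵢ(T ∖ S)`, the points of the handle piece with `x_λ ≠ 0`
(read through Kosinski's involution `α`). [cite: Kosinski1993, VI §6] -/
theorem IsMultiAttachment.range_jA_inter_range_jB {P : Type w} {jA : ↥(coresComplement h) → P}
    {jB : ι → ↥(beltPiece n k) → P}
    (hdisj : Pairwise fun i j => Disjoint (range (h i).toFun) (range (h j).toFun))
    (hglue : ∀ i a b, jA a = jB i b ↔ (h i).glueRel (a : M) b.1) (i : ι) :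
    range jA ∩ range (jB i) =
      jB i '' {b : ↥(beltPiece n k) | lamSq k ((b.1 : EuclideanSpace ℝ (Fin (n + 1)))) ≠ 0} := by
  ext w
  constructor
  · rintro ⟨⟨a, rfl⟩, b, hb⟩
    exact ⟨b, ((hglue i a b).1 hb.symm).lamSq_ne_zero, hb⟩
  · rintro ⟨b, hb0, rfl⟩
    have hb1 : lamSq k ((b.1 : EuclideanSpace ℝ (Fin (n + 1)))) ≠ 1 := b.2
    -- `b = α(y)` for `y = α(b) ∈ T ∖ S`
    set y : ↥(handleTube n k) := handleInversionPt b.1 hb0 hb1 with hy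
    have hy1 : lamSq k y.1.1 ≠ 1 := (handleInversion_mem hb0 hb1).2.2
    have hya : (h i).toFun y ∈ coresComplement h := by
      rw [mem_coresComplement]
      have := apply_notMem_iUnion_core hdisj i y hy1
      rw [mem_compl_iff, mem_iUnion, not_exists] at this
      exact this
    refine ⟨⟨⟨(h i).toFun y, hya⟩, ?_⟩, mem_range_self _⟩
    rw [hglue i]
    refine ⟨y, hy1, ?_, rfl⟩
    show (b.1 : EuclideanSpace ℝ (Fin (n + 1))) =
      handleInversion k (handleInversion k ((b.1 : EuclideanSpace ℝ (Fin (n + 1)))))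
    have h0' : 0 < lamSq k ((b.1 : EuclideanSpace ℝ (Fin (n + 1)))) :=
      lt_of_le_of_ne (lamSq_nonneg k _) (Ne.symm hb0)
    have h1' : lamSq k ((b.1 : EuclideanSpace ℝ (Fin (n + 1)))) < 1 :=
      lt_of_le_of_ne (lamSq_le_one (mem_closedBall_zero_iff.1 b.1.2)) hb1
    rw [handleInversion_handleInversion h0' h1']

end Region

end HandleAttachingMap

/-! ### §3 Realizations without dotted circles: the carved ball is `D⁴` -/

namespace DottedCircleDiagram.Realization

variable {κ : Type v} [Finite κ] {L : FramedLink κ} {P : Type w} [TopologicalSpace P]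
  [ChartedSpace (EuclideanHalfSpace 4) P] (R : (ofFramedLink L).Realization P)

/-- **The identification of the carved ball with `D⁴`** (no dotted circles), `carvedEmbed` read on
the whole carved ball `X₁` — written `a ↦ carvedEmbed ⟨a, _⟩` throughout — is a topological
embedding. [cite: Kirby1989, Ch. I §2] -/
theorem isEmbedding_toBall :
    IsEmbedding fun a : R.carved => R.carvedEmbed ⟨a, R.mem_coresComplement_dual a⟩ := by
  have h₁ : IsEmbedding fun a : R.carved =>
      (⟨a, R.mem_coresComplement_dual a⟩ : ↥(HandleAttachingMap.coresComplement R.dual)) :=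
    IsEmbedding.of_comp (continuous_id.subtype_mk _) continuous_subtype_val IsEmbedding.id
  exact R.isSmoothEmbedding_carvedEmbed.isEmbedding.comp h₁

/-- It is onto: with no dotted circles the carved piece alone covers `D⁴`. [folklore] -/
theorem surjective_toBall :
    Surjective fun a : R.carved => R.carvedEmbed ⟨a, R.mem_coresComplement_dual a⟩ := by
  intro p
  beta_reduce
  have hp : p ∈ range R.carvedEmbed ∪ ⋃ i, range (R.discHandle i) :=
    R.cover_closedBall.symm ▸ mem_univ p
  rcases hp with ⟨a, rfl⟩ | hp
  · exact ⟨a.1, rfl⟩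
  · simp only [mem_iUnion] at hp
    obtain ⟨i, -⟩ := hp
    exact i.elim0

/-- It is a bijection `X₁ ≃ D⁴`. [folklore] -/
theorem bijective_toBall :
    Bijective fun a : R.carved => R.carvedEmbed ⟨a, R.mem_coresComplement_dual a⟩ :=
  ⟨R.isEmbedding_toBall.injective, R.surjective_toBall⟩

/-- **The attaching circles lie on the boundary sphere of `D⁴`**: a point of the `j`-th attaching
circle is sent to a point of norm `1` in `D⁴` (clause `carvedEmbed_handle` of the realization:
on `T ∩ ∂D⁴` the attaching map read in `D⁴` is the tubular neighbourhood `νⱼ` in `S³ = ∂D⁴`).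
[cite: Kirby1989, Ch. I §2] -/
theorem norm_toBall_eq_one_of_mem_core {j : κ} {a : R.carved} (ha : a ∈ (R.handle j).core) :
    ‖(R.carvedEmbed ⟨a, R.mem_coresComplement_dual a⟩).1‖ = 1 := by
  obtain ⟨y, hy, rfl⟩ := (HandleAttachingMap.mem_core_iff _).1 ha
  have hd : tubeDepth y = 0 :=
    (tubeDepth_eq_zero_iff y).2 (norm_eq_one_of_mem_attachingSphereSet 3 2 hy)
  have he : R.carvedEmbed ⟨(R.handle j).toFun y, R.mem_coresComplement_dual _⟩ =
      (closedBallBoundaryData 3).incl (R.tube j (tubeAngle y, tubeFibre y)) :=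
    R.carvedEmbed_handle j y hd
  rw [he, closedBallBoundaryData_incl]
  exact mem_sphere_zero_iff_norm.1 (R.tube j (tubeAngle y, tubeFibre y)).2

/-- **`D⁴` minus the attaching circles is star-shaped about the centre**, read through the
identification `X₁ ≃ D⁴`: the image in `ℝ⁴` of the complement of the attaching circles is
star-convex about `0` (a point `b x`, `0 ≤ b < 1`, has norm `< 1`, and the circles lie on the unit
sphere). [cite: HatcherAT2002, Ch. 0 (p. 4)] -/
theorem starConvex_image_coresComplement :
    StarConvex ℝ (0 : EuclideanSpace ℝ (Fin 4))
      ((fun a : R.carved => (R.carvedEmbed ⟨a, R.mem_coresComplement_dual a⟩).1) ''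
        (HandleAttachingMap.coresComplement R.handle : Set R.carved)) := by
  -- the identification `X₁ ≃ D⁴`
  set tb : R.carved → (Metric.closedBall (0 : EuclideanSpace ℝ (Fin 4)) 1) := fun a =>
    R.carvedEmbed ⟨a, R.mem_coresComplement_dual a⟩ with htb
  have hsurj : Surjective tb := R.surjective_toBall
  have hbij : Bijective tb := R.bijective_toBall
  have hcore : ∀ {j : κ} {a : R.carved}, a ∈ (R.handle j).core → ‖(tb a).1‖ = 1 :=
    fun ha => R.norm_toBall_eq_one_of_mem_core ha
  rintro x ⟨a, ha, rfl⟩ c b hc hb hcb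
  rw [smul_zero, zero_add]
  show b • (tb a).1 ∈ (fun a : R.carved => (tb a).1) '' _
  have hx1 : ‖(tb a).1‖ ≤ 1 := mem_closedBall_zero_iff.1 (tb a).2
  have hbx : ‖b • (tb a).1‖ ≤ 1 := by
    rw [norm_smul, Real.norm_eq_abs, abs_of_nonneg hb]
    calc b * ‖(tb a).1‖ ≤ 1 * 1 := by gcongr; linarith
      _ = 1 := one_mul 1
  obtain ⟨a', ha'⟩ := hsurj ⟨b • (tb a).1, mem_closedBall_zero_iff.2 hbx⟩
  refine ⟨a', ?_, by beta_reduce; rw [ha']⟩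
  -- `a'` is off the attaching circles: otherwise `‖b x‖ = 1` forces `b x = x`
  show a' ∈ (HandleAttachingMap.coresComplement R.handle : Set R.carved)
  rw [SetLike.mem_coe, HandleAttachingMap.mem_coresComplement]
  intro j hj
  have hn : ‖b • (tb a).1‖ = 1 := by
    have := hcore hj
    rwa [ha'] at this
  rw [norm_smul, Real.norm_eq_abs, abs_of_nonneg hb] at hn
  have hb1 : b ≤ 1 := by linarith
  have hb_eq : b = 1 := by
    by_contra hne
    have hlt : b < 1 := lt_of_le_of_ne hb1 hne
    nlinarith [norm_nonneg (tb a).1]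
  have heq : tb a' = tb a := by
    rw [ha']
    refine Subtype.ext ?_
    show b • ((tb a).1) = _
    rw [hb_eq, one_smul]
  have haa' : a' = a := hbij.1 heq
  rw [haa'] at hj
  exact ((HandleAttachingMap.mem_coresComplement _).1 ha j) hj

/-- **The complement of the attaching circles in the carved ball `D⁴` is contractible**
(star-shaped about the centre). [cite: HatcherAT2002, Ch. 0 (p. 4)] -/
theorem contractibleSpace_coresComplement :
    ContractibleSpace ↥(HandleAttachingMap.coresComplement R.handle) := by
  set A : Set R.carved := (HandleAttachingMap.coresComplement R.handle : Set R.carved) with hA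
  set tb : R.carved → (Metric.closedBall (0 : EuclideanSpace ℝ (Fin 4)) 1) := fun a =>
    R.carvedEmbed ⟨a, R.mem_coresComplement_dual a⟩ with htb
  set e : ↥(HandleAttachingMap.coresComplement R.handle) → EuclideanSpace ℝ (Fin 4) := fun a =>
    (tb a.1).1 with he
  have hemb : IsEmbedding e :=
    IsEmbedding.subtypeVal.comp (R.isEmbedding_toBall.comp IsEmbedding.subtypeVal)
  have hrange : range e = (fun a : R.carved => (tb a).1) '' A := by
    ext x
    constructor
    · rintro ⟨a, rfl⟩
      exact ⟨a.1, a.2, rfl⟩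
    · rintro ⟨a, ha, rfl⟩
      exact ⟨⟨a, ha⟩, rfl⟩
  -- the centre `0` of `D⁴` is off the attaching circles
  obtain ⟨a₀, ha₀⟩ := (R.surjective_toBall : Surjective tb) ⟨0, by simp⟩
  have ha₀' : tb a₀ = ⟨0, by simp⟩ := ha₀
  have ha₀'' : R.carvedEmbed ⟨a₀, R.mem_coresComplement_dual a₀⟩ = ⟨0, by simp⟩ := ha₀
  have ha₀A : a₀ ∈ A := by
    rw [hA, SetLike.mem_coe, HandleAttachingMap.mem_coresComplement]
    intro j hj
    have := R.norm_toBall_eq_one_of_mem_core hj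
    rw [ha₀''] at this
    norm_num at this
  have h0 : (0 : EuclideanSpace ℝ (Fin 4)) ∈ range e := by
    rw [hrange]
    exact ⟨a₀, ha₀A, by beta_reduce; rw [ha₀']⟩
  haveI : ContractibleSpace ↥(range e) := by
    have hstar := R.starConvex_image_coresComplement
    rw [← hrange] at hstar
    exact hstar.contractibleSpace ⟨0, h0⟩
  exact hemb.toHomeomorph.symm.toHomotopyEquiv.symm.contractibleSpace_iff.2 inferInstance

/-- The base piece `glued(X₁ ∖ ⋃ cores)` of the trace is simply connected. [folklore] -/
theorem isSimplyConnected_range_glued : IsSimplyConnected (range R.glued) := by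
  haveI := R.contractibleSpace_coresComplement
  rw [← image_univ, R.isSmoothEmbedding_glued.isEmbedding.isSimplyConnected_image]
  exact (Homeomorph.Set.univ ↥(HandleAttachingMap.coresComplement R.handle)).toHomotopyEquiv
    |>.simplyConnectedSpace_iff.2 inferInstance

/-- Each handle piece `D⁴ ∖ S` of the trace is simply connected.
[cite: HatcherAT2002, Ch. 0 (p. 4)] -/
theorem isSimplyConnected_range_handlePiece (j : κ) :
    IsSimplyConnected (range (R.handlePiece j)) := by
  rw [← image_univ, (R.isSmoothEmbedding_handlePiece j).isEmbedding.isSimplyConnected_image]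
  exact isSimplyConnected_beltPiece₄_univ

/-- The base piece meets the `j`-th handle piece in the (path connected) image of the punctured
tube `T ∖ S`. [cite: Kosinski1993, VI §6] -/
theorem isPathConnected_range_glued_inter (j : κ) :
    IsPathConnected (range R.glued ∩ range (R.handlePiece j)) := by
  rw [HandleAttachingMap.IsMultiAttachment.range_jA_inter_range_jB R.disjoint_handle
    R.glued_eq_handlePiece_iff j]
  exact isPathConnected_beltPiece₄_lamSq_ne_zero.image
    (R.isSmoothEmbedding_handlePiece j).isEmbedding.continuous

/-- **The `4`-manifold presented by a Kirby diagram without dotted circles is simply connected**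
("since no `1`-handles are attached", Gompf–Scharlemann–Thompson 2010, §9; Gompf–Stipsicz 1999,
§4.4): van Kampen for Kosinski's open cover of `P` by `D⁴ ∖ ⋃ cores` and the handle pieces.
[cite: GompfScharlemannThompson2010, §9 (arXiv p. 19)] [cite: GompfStipsicz1999, §4.4] -/
theorem simplyConnectedSpace_of_ofFramedLink (R : (ofFramedLink L).Realization P) :
    SimplyConnectedSpace P :=
  simplyConnectedSpace_of_isOpen_of_iUnion R.isOpen_range_glued R.isOpen_range_handlePiece
    R.isSimplyConnected_range_glued R.isSimplyConnected_range_handlePiece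
    R.isPathConnected_range_glued_inter R.disjoint_handlePiece R.cover

end DottedCircleDiagram.Realization

/-! ### §4 The trace of a framed link -/

namespace FramedLink

variable {ι : Type v} [Finite ι] {L : FramedLink ι} {P : Type w} [TopologicalSpace P]
  [ChartedSpace (EuclideanHalfSpace 4) P]

/-- **The trace `B⁴ ∪_L (2-handles)` of a framed link is simply connected** (no `1`-handles:
Gompf–Scharlemann–Thompson 2010, §9; Gompf–Stipsicz 1999, §4.4).
[cite: GompfScharlemannThompson2010, §9 (arXiv p. 19)] [cite: GompfStipsicz1999, §4.4] -/
theorem IsTrace.simplyConnectedSpace (h : L.IsTrace P) : SimplyConnectedSpace P := by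
  obtain ⟨R⟩ := h
  exact R.simplyConnectedSpace_of_ofFramedLink

/-- The trace of a framed link is path connected. [folklore] -/
theorem IsTrace.pathConnectedSpace (h : L.IsTrace P) : PathConnectedSpace P := by
  haveI := h.simplyConnectedSpace
  infer_instance

/-- The trace of a framed link is nonempty (it contains the `0`-handle). [folklore] -/
theorem IsTrace.nonempty (h : L.IsTrace P) : Nonempty P := by
  haveI := h.pathConnectedSpace
  infer_instance

end FramedLink

end Literature.Topology.FourManifolds
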